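import Summits.ResolutionOfSingularities.ResolutionOfSingularities.Theorems.FrobeniusClosingPatchingRelPerfectDepthTraceEquimultipleOrder
import Summits.ResolutionOfSingularities.ResolutionOfSingularities.Theorems.FrobeniusClosingPatchingRelPerfectDepthParamLiftFlatConverse
import Summits.ResolutionOfSingularities.ResolutionOfSingularities.Theorems.FrobeniusClosingPatchingRelPerfectDepthMultiHostCylSnc
import Literature.AlgebraicGeometry.Resolution.BlowupRestrictOpen
import Literature.AlgebraicGeometry.Resolution.OrderFlatLocalHom
import Literature.AlgebraicGeometry.Resolution.StalkIdealLemmas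
import HarnessLib

/-!
# Crux `PatchingRelPerfect` (stmt-ResolutionOfSingularities-16161), chain W5.2 — F7(β) (β-AX) T3 extraction glue, LAYER C (C2) + EXPORT:
# host orders on `X` along the pushed centre equal the v7 exponents

[OURS · L1 W5.2 · F7(β) (β-AX) · res-L1-w52-plan-1 NAMING G12-33 «(C2) + the export `hequiX`»] res-L1-w52-stub-1 g5.  Replaces the role of NO
printed item; NOT a statement of the manuscript under review (AI-written, weaker than expert review).

* `idealOrder_comap_eq_of_isParamLiftAt` — POINTWISE form of «orders are preserved by a flat local homomorphism with regular closed fibre»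
  (tree `map_le_pow_maximalIdeal_iff_of_isRegularLocalRing_fiber` + `stalkIdeal_comap_eq_map_stalkMap`; flatness and the regular fibre from
  PARAM-LIFT, `IsParamLiftAt.flat` / `.isRegularLocalRing_fiber`): `idealOrder (I.comap q) y = idealOrder I (q y)`.
* **(C2) `CylState.idealOrder_host_j`** — `idealOrder (S.host i) (cyl.j z) = idealOrder (cyl.tr i) z`: the cylinder identity
  `host i|_V = q^*(tr i)` read at `jV z`, the open immersion `V.ι` (`idealOrder_comap_of_isOpenImmersion`), the retraction `q (jV z) = z`.
* `isGenericPoint_of_isGenericPoint_image` — generic points transport back through the closed immersion `cyl.j`.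
* **EXPORT `CylState.hequiX_of_binders`** (res-L1-w52-lead-1΄s shape): from the v7 `StepStable` binders `hC`, `D`/`hD`, `hsub`, `hperm`,
  `η`/`IsGenericPoint η (cyl.centre C)`, `hm`, `hm'`, plus regularity of `X` and of the cylinder: **`∀ i, ∀ y ∈ cyl.centre C,
  idealOrder (S.host i) y = m i`** (layer C (C1) `trace_idealOrder_eq` p565108 on the carrier + (C2)).

Fact-free.
-/

-- `Summit.<Summit>.<Sub>.Theorems` with `Sub = Summit` (single-conjunct summit, D-0017)
set_option linter.dupNamespace false

noncomputable section

open IsLocalRing CategoryTheory AlgebraicGeometry TopologicalSpace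
open Literature.RingTheory.HilbertSamuel Literature.AlgebraicGeometry.Resolution Scheme.IdealSheafData

namespace Summit.ResolutionOfSingularities.ResolutionOfSingularities.Theorems.DepthMultiHost

universe u

/-! ## Orders along a param-lift retraction -/

/-- **Orders are preserved by a morphism that lifts parameters at the point** (flat with regular closed fibre):
`ord_y(q^*I) = ord_{q y}(I)`. [cite: Matsumura1987, §22 Cor. to Thm. 22.5, Thm. 23.1] -/
theorem idealOrder_comap_eq_of_isParamLiftAt {V Z : Scheme.{u}} (q : V ⟶ Z) (y : V) [IsRegularLocalRing (Z.presheaf.stalk (q y))]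
    [IsRegularLocalRing (V.presheaf.stalk y)] (h : IsParamLiftAt q y) (I : Z.IdealSheafData) :
    idealOrder (I.comap q) y = idealOrder I (q y) := by
  letI := (q.stalkMap y).hom.toAlgebra
  haveI : Module.Flat (Z.presheaf.stalk (q y)) (V.presheaf.stalk y) := h.flat
  haveI : IsLocalHom (algebraMap (Z.presheaf.stalk (q y)) (V.presheaf.stalk y)) := inferInstanceAs (IsLocalHom (q.stalkMap y).hom)
  have hreg := h.isRegularLocalRing_fiber
  have key : ∀ n : ℕ, (n : ℕ∞) ≤ idealOrder (I.comap q) y ↔ (n : ℕ∞) ≤ idealOrder I (q y) := by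
    intro n
    rw [le_idealOrder_iff, le_idealOrder_iff, stalkIdeal_comap_eq_map_stalkMap]
    exact map_le_pow_maximalIdeal_iff_of_isRegularLocalRing_fiber hreg n (stalkIdeal I (q y))
  refine le_antisymm ?_ ?_
  · exact ENat.forall_natCast_le_iff_le.mp fun n hn => (key n).mp hn
  · exact ENat.forall_natCast_le_iff_le.mp fun n hn => (key n).mpr hn

namespace CylState

variable {X : Scheme.{u}} {S : MultiHostState X} (cyl : CylState S)

/-- [OURS · L1 W5.2 · F7(β) (β-AX) T3 glue, (C2)] **Host orders on `X` at points of the carrier are the trace orders**: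
`idealOrder (S.host i) (cyl.j z) = idealOrder (cyl.tr i) z` (cylinder identity + open immersion + param-lift retraction), at every point `z`
of the carrier where `X` (at `j z`) and the carrier (at `z`) have regular local rings. [cite: Matsumura1987, Thm. 23.1] -/
theorem idealOrder_host_j (i : Fin S.n) (z : cyl.Z) [hX : IsRegularLocalRing (X.presheaf.stalk (cyl.j z))]
    [hZ : IsRegularLocalRing (cyl.Z.presheaf.stalk z)] : idealOrder (S.host i) (cyl.j z) = idealOrder (cyl.tr i) z := by
  set y : ↥cyl.V := cyl.jV z with hy_def
  have hιy : cyl.V.ι y = cyl.j z := cyl.V_ι_jV z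
  have hqy : cyl.q y = z := cyl.q_jV z
  haveI : IsRegularLocalRing ((cyl.V : Scheme.{u}).presheaf.stalk y) := by
    have e := (asIso (cyl.V.ι.stalkMap y)).commRingCatIsoToRingEquiv
    rw [← hιy] at hX
    exact IsRegularLocalRing.of_ringEquiv e
  haveI : IsRegularLocalRing (cyl.Z.presheaf.stalk (cyl.q y)) := by rw [hqy]; exact hZ
  rw [← hιy, ← idealOrder_comap_of_isOpenImmersion cyl.V.ι (S.host i) y, cyl.host_eq i,
    idealOrder_comap_eq_of_isParamLiftAt cyl.q y (cyl.param y) (cyl.tr i), hqy]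

/-- Generic points transport back through the closed immersion `cyl.j`: a generic point of the pushed centre `j '' V(C)` is the image of a
generic point of `V(C)`. [folklore] -/
theorem exists_isGenericPoint_of_centre (C : cyl.Z.IdealSheafData) {η : X} (hη : IsGenericPoint η (cyl.centre C : Set X)) :
    ∃ η' : cyl.Z, cyl.j η' = η ∧ IsGenericPoint η' (C.support : Set cyl.Z) := by
  haveI := cyl.closedImmersion
  have hj : Topology.IsClosedEmbedding cyl.j := cyl.j.isClosedEmbedding
  obtain ⟨η', hη'C, rfl⟩ := (cyl.mem_centre_iff C η).mp hη.mem
  refine ⟨η', rfl, ?_⟩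
  change closure ({η'} : Set cyl.Z) = (C.support : Set cyl.Z)
  apply Set.image_injective.mpr hj.injective
  rw [← hj.closure_image_eq, Set.image_singleton]
  exact hη.def

/-- [OURS · L1 W5.2 · F7(β) (β-AX) T3 glue, EXPORT in res-L1-w52-lead-1΄s shape] **`hequiX`: along the pushed centre every host has order equal
to its v7 exponent.**  From the v7 `StepStable` binders (`hC`, `D`/`hD`, `hsub`, `hperm`, `η`, `hm`, `hm'`) plus regularity of `X` on the
pushed centre and of the cylinder: `∀ i, ∀ y ∈ cyl.centre C, idealOrder (S.host i) y = m i`. [cite: CossartJannsenSaito2020, Thm. 3.3] -/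
theorem hequiX_of_binders [IsLocallyNoetherian cyl.Z] (hX : ∀ y ∈ (cyl.V : Set X), IsRegularLocalRing (X.presheaf.stalk y))
    (hZ : Scheme.IsRegular cyl.Z) (C : cyl.Z.IdealSheafData) (hC : Scheme.IsRegular C.subscheme) (D : Closeds cyl.Z)
    (hD : (D : Set cyl.Z) = ⋃ i, ((cyl.tr i).support : Set cyl.Z)) (hsub : vanishingIdeal D ≤ C)
    (hperm : ∀ x ∈ (C.support : Set cyl.Z), ((stalkIdeal C x).map (Ideal.Quotient.mk (stalkIdeal (vanishingIdeal D) x))).IsPermissible)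
    {η : X} (hη : IsGenericPoint η (cyl.centre C : Set X)) (m : Fin S.n → ℕ) (hm : ∀ i, cyl.tr i ≤ C ^ m i)
    (hm' : ∀ i, ¬ cyl.tr i ≤ C ^ (m i + 1)) :
    ∀ i, ∀ y ∈ (cyl.centre C : Set X), idealOrder (S.host i) y = m i := by
  intro i y hy
  obtain ⟨z, hz, rfl⟩ := (cyl.mem_centre_iff C y).mp hy
  obtain ⟨η', -, hη'⟩ := cyl.exists_isGenericPoint_of_centre C hη
  haveI : IsRegularLocalRing (X.presheaf.stalk (cyl.j z)) := hX _ (cyl.range_j_subset ⟨z, rfl⟩)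
  haveI : IsRegularLocalRing (cyl.Z.presheaf.stalk z) := hZ z
  rw [cyl.idealOrder_host_j i z]
  exact DepthEquimultiple.trace_idealOrder_eq hZ cyl.tr cyl.tr_isEffectiveCartier D hD C hC hη' hsub hperm i (hm i) (hm' i) hz

end CylState

end Summit.ResolutionOfSingularities.ResolutionOfSingularities.Theorems.DepthMultiHost

end
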